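import Literature.IUT.HodgeTheaters.PuncturedEllipticDihedralProfiniteModelOrigin
import Literature.IUT.HodgeTheaters.PuncturedEllipticProLModelTransfer
import HarnessLib

/-!
# [IUTchI] §1: the DIHEDRAL PROFINITE MODEL — part 4: the cusp action `CuspGalois` at the datum (the permutation
# action of `Π_C = Ŵ` on the cusps `ℤ/l` of `X̲` through `Ŵ ↠ D_l`, with all eleven laws)

Mochizuki, *Inter-universal Teichmüller theory I: construction of Hodge theaters*, kurims manuscript (May 2020),
§1 p. 37 ("`Gal(X̲/X) ≅ Q`, a free `ℤ/lℤ`-module of rank `1` … `ε⁰` the unique zero cusp of `X̲` … `ε′, ε″` the two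
cusps of `X̲` that lie over `ε̲` … `ι̲ ∈ Gal(X̲/C̲)`") [cite: Mochizuki2012, IUTchI §1 p.37] (D-0012 claim key; series
status DISPUTED — nothing of the series is asserted here); S. Mochizuki, *Topics in Absolute Anabelian Geometry I*,
Lemma 4.5 (i) p. 54 [cite: MochizukiAbsTopI2012, Lemma 4.5 (i) p.54].

Cell abc-iut, seat abc-iut-L5-t1 gen 12, L5 ROWS #7 R48 residual «NV-JOINT» (sequel of parts 1–3).  CONTENTS:
§1 `Π_X̲`-CONJUGATION OF THE CUSP GROUPS (`act_decomp`): for `g ∈ Ŵ` choose `w ∈ W` with `ρ w = ρ̂ g` (surjectivity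
of `ρ`), conjugate the word `γ_{sec x}` by `w` (part 1's `exists_kerConj_γ`: `w γ w⁻¹ = u γ_{n′} u⁻¹`, `ρ u = 1`, `lab n′ =
ρ(w)·x`), renormalise `n′` to `sec (ρ̂ g · x)` (`exists_kerConj_γ_of_modEq`), and set `t := η(v) g⁻¹ ∈ Ker ρ̂` — then
`(t g) D_x (t g)⁻¹ = D_{ρ̂ g · x}` on the nose (abc-iut-L5-d4's `conj_smul_topologicalClosure_zpowers`); §2 DISTINCT
CUSPS HAVE NON-`Π_X̲`-CONJUGATE GROUPS (`eq_of_conj`): abc-iut-L5-d4's continuous SHADOW `F : Δ_X → P_l =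
ℤ_l^{ℤ/l} ⋊ (ℤ_l ⋊ ℤ/2)` (`exists_shadowHom`, `a ↦ a`, `b ↦ B₀`) satisfies `(P_l ↠ D_l) ∘ F = ρ̂|_{Δ_X}` (two continuous
homomorphisms agreeing on the free generators, `IsFreeProOn.continuous_hom_ext`), carries `D_x = η(aⁿ)⟨[ηa,ηb]⟩⁻η(aⁿ)⁻¹`
ONTO the model line `D_{(ρ̂ η aⁿ)·0} = D_{n}` (`map_inertia_eq`), and `Ker ρ̂` acts trivially on the lines
(`conj_smul_Dm`); the lines are pairwise distinct (`Dm_injective`, `l ≥ 5`); §3 the eight small laws read off `ρ̂`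
(`free`, `transitive`, `exists_generator`, `conj_mul_mem_PiXbar`, `act_ε0`, `act_ε1`, `act_twoε`, closedness); §4
**`DihedralProfiniteModel.cuspGalois l h5 : (datum l h5).CuspGalois`** and `nonempty_cuspGalois`.

HONEST LABEL: a group-theoretic model (profinite completion of the topological orbifold group of `C` with its
dihedral covering tower), not the étale `π₁` of a `k`-scheme; the interface `CuspGalois` (abc-iut-L5-t1 p424023) is
INHABITED here jointly with `GeomOriginIota` (part 3), nothing more; no instance, no notation, no `Prop`-valued
definition; nothing here bears on [IUTchIII] Cor. 3.12 or asserts that abc is proved or refuted; no side taken.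
-/

noncomputable section

open CategoryTheory Topology ProfiniteGrp DihedralGroup

namespace Literature.IUT.HodgeTheaters

namespace PuncturedEllipticData

namespace DihedralProfiniteModel

open Literature.AnabelianGeometry.AbsoluteAnabelian Literature.IUT.HodgeTheaters.ProfiniteCompletion
open scoped Pointwise

variable (l : ℕ) [Fact l.Prime]

/-! ### §1. `Π_X̲`-conjugation of the cusp groups -/

/-- **The conjugation law `act_decomp` at the datum**: for every `g ∈ Ŵ` and cusp `x` there is `t ∈ Ker ρ̂ = Π_X̲`
with `(t g) D_x (t g)⁻¹ = D_{ρ̂(g)·x}`. [cite: Mochizuki2012, IUTchI §1 p.37] -/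
theorem exists_conj_decompW (h5 : 5 ≤ l) (g : profiniteCompletion W) (x : ZMod l) :
    ∃ t ∈ (ρhat l).ker, MulAut.conj (t * g) • decompW l x = decompW l (ArrowModel.cuspAct l (ρhat l g) x) := by
  haveI : NeZero l := neZero_l l
  obtain ⟨w, hw⟩ := ρW_surjective l (ρhat l g)
  obtain ⟨n', u, hu, hlab, he⟩ := exists_kerConj_γ l ((Fact.out : l.Prime).odd_of_ne_two (by omega)) w (sec l x)
  rw [hw, lab_sec] at hlab
  set m : ℤ := sec l (ArrowModel.cuspAct l (ρhat l g) x) with hm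
  have hmod : (n' : ZMod l) = m := by
    rw [← lab_eq_lab_iff, hlab, hm, lab_sec]
  obtain ⟨u', hu', he'⟩ := exists_kerConj_γ_of_modEq l hmod
  -- `v γ_{sec x} v⁻¹ = γ_m` with `ρ v = ρ̂ g`
  set v : W := (u * u')⁻¹ * w with hv
  have hev : v * SemidirectProduct.inl (γ (sec l x)) * v⁻¹ = SemidirectProduct.inl (γ m) := by
    rw [hv, show (u * u')⁻¹ * w * SemidirectProduct.inl (γ (sec l x)) * ((u * u')⁻¹ * w)⁻¹ =
      (u * u')⁻¹ * (w * SemidirectProduct.inl (γ (sec l x)) * w⁻¹) * (u * u') by group, he, he']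
    group
  have hρv : ρW l v = ρhat l g := by
    rw [hv, map_mul, map_inv, map_mul, hu, hu', mul_one, inv_one, one_mul, hw]
  refine ⟨toCompletion W v * g⁻¹, ?_, ?_⟩
  · rw [MonoidHom.mem_ker, map_mul, map_inv, ρhat_eta, hρv, mul_inv_cancel]
  · rw [inv_mul_cancel_right, decompW, decompW, ProLModel.conj_smul_topologicalClosure_zpowers, ← map_inv, ← map_mul,
      ← map_mul, hev]

/-! ### §2. Distinct cusps have non-`Π_X̲`-conjugate groups (the shadow in `P_l`) -/

/-- `(P_l ↠ D_l)` is continuous for any topology on `D_l` making it discrete… we only need: it is locally constant,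
hence continuous for the discrete topology. [cite: Mochizuki2012, IUTchI §1 p.37] -/
theorem continuous_toDihP [TopologicalSpace (DihedralGroup l)] : Continuous (ProLModel.toDihP l) :=
  (ProLModel.isLocallyConstant_toDihP l).continuous

/-- **The shadow respects the dihedral quotient**: for a continuous `F : Δ_X → P_l` with `F(ηa) = a`, `F(ηb) = B₀`,
`(P_l ↠ D_l)(F g) = ρ̂ g` for all `g ∈ Δ_X` (both sides are continuous homomorphisms `Δ_X → D_l` agreeing on the free
generators; `IsFreeProOn.continuous_hom_ext`). [cite: MochizukiAbsTopI2012, Lemma 4.5 (i) p.54] -/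
theorem toDihP_shadow_eq (h5 : 5 ≤ l) (F : ↥((datum l h5).PiX ⊓ (datum l h5).DeltaC) →* ProLModel.P l)
    (hF : Continuous F) (h0 : F ((geomOriginIota l h5).gens 0) = ProLModel.elA l 1)
    (h1 : F ((geomOriginIota l h5).gens 1) = ProLModel.inN l (ProLModel.δ l 0))
    (g : ↥((datum l h5).PiX ⊓ (datum l h5).DeltaC)) :
    ProLModel.toDihP l (F g) = ρhat l (g : profiniteCompletion W) := by
  letI : TopologicalSpace (DihedralGroup l) := ⊥
  haveI : DiscreteTopology (DihedralGroup l) := ⟨rfl⟩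
  haveI : CompactSpace ↥((datum l h5).PiX ⊓ (datum l h5).DeltaC) :=
    isCompact_iff_compactSpace.mp (datum l h5).isClosed_piX_inf_deltaC.isCompact
  have h := (geomOriginIota l h5).isFreeProOn.continuous_hom_ext (F₁ := (ProLModel.toDihP l).comp F)
    (F₂ := (ρhat l).comp ((datum l h5).PiX ⊓ (datum l h5).DeltaC).subtype) ((continuous_toDihP l).comp hF)
    ((continuous_ρhat l).comp continuous_subtype_val) (by
      intro i
      fin_cases i
      · change ProLModel.toDihP l (F ((geomOriginIota l h5).gens 0)) =
          ρhat l (toCompletion W (SemidirectProduct.inl ga))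
        rw [h0, ρhat_eta, ρW_inl, ρF_ga, ProLModel.toDihP_apply,
          ProLModel.toDih_right_of_mem_PiXm l (ProLModel.elA_mem_PiXm l 1)]
        change r (PadicInt.toZMod (Multiplicative.toAdd (Multiplicative.ofAdd (1 : ℤ_[l])))) = r 1
        rw [toAdd_ofAdd, map_one]
      · change ProLModel.toDihP l (F ((geomOriginIota l h5).gens 1)) =
          ρhat l (toCompletion W (SemidirectProduct.inl gb))
        rw [h1, ρhat_eta, ρW_inl, ρF_gb, ProLModel.toDihP_apply, ProLModel.inN_right, map_one])
  exact DFunLike.congr_fun h g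

/-- The label read off the shadow: `(F g)·0 = ρ̂(g)·0`. [cite: Mochizuki2012, IUTchI §1 p.37] -/
theorem cuspAct_toDih_shadow (h5 : 5 ≤ l) (F : ↥((datum l h5).PiX ⊓ (datum l h5).DeltaC) →* ProLModel.P l)
    (hF : Continuous F) (h0 : F ((geomOriginIota l h5).gens 0) = ProLModel.elA l 1)
    (h1 : F ((geomOriginIota l h5).gens 1) = ProLModel.inN l (ProLModel.δ l 0))
    (g : ↥((datum l h5).PiX ⊓ (datum l h5).DeltaC)) :
    ArrowModel.cuspAct l (ProLModel.toDih l (F g).right) 0 =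
      ArrowModel.cuspAct l (ρhat l (g : profiniteCompletion W)) 0 := by
  rw [← ProLModel.toDihP_apply, toDihP_shadow_eq l h5 F hF h0 h1]

/-- `ρ̂(η aⁿ) · 0 = n`. [cite: Mochizuki2012, IUTchI §1 p.37] -/
theorem cuspAct_ρhat_eta_ga_zpow (n : ℤ) :
    ArrowModel.cuspAct l (ρhat l (toCompletion W (SemidirectProduct.inl (ga ^ n)))) 0 = (n : ZMod l) := by
  rw [ρhat_eta, ρW_inl, ρF_ga_zpow, ArrowModel.cuspAct_r, zero_add]

/-- `η(inl x) ∈ Δ_X` in the datum's spelling. [cite: Mochizuki2012, IUTchI §1 p.37] -/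
theorem eta_inl_mem_datum_deltaX (h5 : 5 ≤ l) (x : FreeGroup (Fin 2)) :
    toCompletion W (SemidirectProduct.inl x) ∈ (datum l h5).PiX ⊓ (datum l h5).DeltaC :=
  ⟨(eta_mem_PiXW_iff l _).2 ⟨x, rfl⟩, by rw [(datum_unfold l h5).2.2.2.2.1]; trivial⟩

/-- `Ker ρ̂ ≤ Δ_X` in the datum's spelling. [cite: Mochizuki2012, IUTchI §1 p.37] -/
theorem mem_datum_deltaX_of_mem_ker (h5 : 5 ≤ l) {t : profiniteCompletion W} (ht : t ∈ (ρhat l).ker) :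
    t ∈ (datum l h5).PiX ⊓ (datum l h5).DeltaC :=
  ⟨(mem_PiXW_iff l t).2 ⟨0, by rw [(MonoidHom.mem_ker).1 ht, one_def]⟩,
    by rw [(datum_unfold l h5).2.2.2.2.1]; trivial⟩

/-- **The separation law `eq_of_conj` at the datum**: if `t ∈ Ker ρ̂ = Π_X̲` conjugates `D_x` onto `D_y` then `x = y`
— the shadow carries `t D_x t⁻¹ = (t η a^{sec x}) ⟨[ηa,ηb]⟩⁻ (…)⁻¹` onto the line `D_{sec x}` and `D_y` onto `D_{sec y}`,
and distinct lines are distinct (`l ≥ 5`). [cite: Mochizuki2012, IUTchI §1 p.37] -/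
theorem eq_of_conj_decompW (h5 : 5 ≤ l) (x y : ZMod l) {t : profiniteCompletion W} (ht : t ∈ (ρhat l).ker)
    (hxy : MulAut.conj t • decompW l x = decompW l y) : x = y := by
  classical
  haveI : NeZero l := neZero_l l
  obtain ⟨F, hF, h0, h1⟩ := ProLModel.exists_shadowHom l (datum l h5) (geomOriginIota l h5).isFreeProOn
    (ProLModel.elA l 1) (ProLModel.inN l (ProLModel.δ l 0))
  -- the conjugators lie in `Δ_X`
  have htgx : t * toCompletion W (SemidirectProduct.inl (ga ^ sec l x)) ∈ (datum l h5).PiX ⊓ (datum l h5).DeltaC :=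
    Subgroup.mul_mem _ (mem_datum_deltaX_of_mem_ker l h5 ht) (eta_inl_mem_datum_deltaX l h5 _)
  have hgy := eta_inl_mem_datum_deltaX l h5 (ga ^ sec l y)
  -- the commutator of the record's generators, spelled in `Ŵ`
  have hc : ((geomOriginIota l h5).gens 0 : (datum l h5).PiC) * ((geomOriginIota l h5).gens 1 : (datum l h5).PiC) *
      ((geomOriginIota l h5).gens 0 : (datum l h5).PiC)⁻¹ * ((geomOriginIota l h5).gens 1 : (datum l h5).PiC)⁻¹ =
      toCompletion W (SemidirectProduct.inl ga) * toCompletion W (SemidirectProduct.inl gb) *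
        (toCompletion W (SemidirectProduct.inl ga))⁻¹ * (toCompletion W (SemidirectProduct.inl gb))⁻¹ := rfl
  -- both sides of `hxy` in the shape of `map_inertia_eq`
  have hIx : MulAut.conj t • (datum l h5).decomp x = (Subgroup.zpowers
      ((t * toCompletion W (SemidirectProduct.inl (ga ^ sec l x))) *
        (((geomOriginIota l h5).gens 0 : (datum l h5).PiC) * ((geomOriginIota l h5).gens 1 : (datum l h5).PiC) *
          ((geomOriginIota l h5).gens 0 : (datum l h5).PiC)⁻¹ *
          ((geomOriginIota l h5).gens 1 : (datum l h5).PiC)⁻¹) *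
        (t * toCompletion W (SemidirectProduct.inl (ga ^ sec l x)))⁻¹)).topologicalClosure := by
    rw [hc]
    change MulAut.conj t • decompW l x = _
    rw [decompW, ProLModel.conj_smul_topologicalClosure_zpowers, eta_inl_γ]
    congr 2
    group
  have hIy : (datum l h5).decomp y = (Subgroup.zpowers
      (toCompletion W (SemidirectProduct.inl (ga ^ sec l y)) *
        (((geomOriginIota l h5).gens 0 : (datum l h5).PiC) * ((geomOriginIota l h5).gens 1 : (datum l h5).PiC) *
          ((geomOriginIota l h5).gens 0 : (datum l h5).PiC)⁻¹ *
          ((geomOriginIota l h5).gens 1 : (datum l h5).PiC)⁻¹) *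
        (toCompletion W (SemidirectProduct.inl (ga ^ sec l y)))⁻¹)).topologicalClosure := by
    rw [hc]
    change decompW l y = _
    rw [decompW, eta_inl_γ]
  -- apply the shadow
  have hxy' : MulAut.conj t • (datum l h5).decomp x = (datum l h5).decomp y := hxy
  have himg := congrArg
    (fun H : Subgroup (datum l h5).PiC => (H.subgroupOf ((datum l h5).PiX ⊓ (datum l h5).DeltaC)).map F) hxy'
  simp only at himg
  rw [ProLModel.map_inertia_eq l F hF h0 h1 htgx hIx, ProLModel.map_inertia_eq l F hF h0 h1 hgy hIy,
    cuspAct_toDih_shadow l h5 F hF h0 h1, cuspAct_toDih_shadow l h5 F hF h0 h1] at himg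
  have hlab := ProLModel.Dm_injective l h5 himg
  change ArrowModel.cuspAct l (ρhat l (t * toCompletion W (SemidirectProduct.inl (ga ^ sec l x)))) 0 =
    ArrowModel.cuspAct l (ρhat l (toCompletion W (SemidirectProduct.inl (ga ^ sec l y)))) 0 at hlab
  rw [map_mul, (MonoidHom.mem_ker).1 ht, one_mul, cuspAct_ρhat_eta_ga_zpow, cuspAct_ρhat_eta_ga_zpow, sec, sec,
    Int.cast_natCast, Int.cast_natCast, ZMod.natCast_zmod_val, ZMod.natCast_zmod_val] at hlab
  exact add_right_cancel hlab

/-! ### §3. The cusp action and its small laws -/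

/-- **The cusp action of `Π_C = Ŵ` on the cusps `ℤ/l` of `X̲`**, through `ρ̂ : Ŵ ↠ D_l` and this lineage's
`ArrowModel.cuspHom` (`r_k : i ↦ i + k`, `s r_k : i ↦ −k − i`). [cite: Mochizuki2012, IUTchI §1 p.37] -/
def actW : profiniteCompletion W →* Equiv.Perm (ZMod l) := (ArrowModel.cuspHom l).comp (ρhat l)

/-- `act g i = cuspAct (ρ̂ g) i`. [cite: Mochizuki2012, IUTchI §1 p.37] -/
@[simp] theorem actW_apply (g : profiniteCompletion W) (i : ZMod l) : actW l g i = ArrowModel.cuspAct l (ρhat l g) i :=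
  rfl

/-- `Gal(X̲/X) = Π_X/Π_X̲` acts FREELY: a rotation with a fixed cusp is trivial. [cite: Mochizuki2012, IUTchI §1 p.37] -/
theorem actW_free {g : profiniteCompletion W} (hg : g ∈ PiXW l) (x : ZMod l) (h : actW l g x = x) :
    g ∈ (ρhat l).ker := by
  obtain ⟨k, hk⟩ := (mem_PiXW_iff l g).1 hg
  rw [actW_apply, hk, ArrowModel.cuspAct_r, add_eq_left] at h
  rw [MonoidHom.mem_ker, hk, h, one_def]

/-- … and TRANSITIVELY (`η(a)^{y−x}` carries `x` to `y`). [cite: Mochizuki2012, IUTchI §1 p.37] -/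
theorem actW_transitive (x y : ZMod l) :
    ∃ g ∈ PiXW l, actW l g x = y := by
  haveI : NeZero l := neZero_l l
  refine ⟨toCompletion W (SemidirectProduct.inl (ga ^ ((y - x).val : ℤ))), (eta_mem_PiXW_iff l _).2 ⟨_, rfl⟩, ?_⟩
  rw [actW_apply, ρhat_eta, ρW_inl, ρF_ga_zpow, ArrowModel.cuspAct_r, Int.cast_natCast, ZMod.natCast_zmod_val,
    add_sub_cancel]

/-- … through the CYCLIC group generated by the image of `η a`. [cite: Mochizuki2012, IUTchI §1 p.37] -/
theorem actW_exists_generator :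
    ∃ g ∈ PiXW l, ∀ h ∈ PiXW l, ∃ n : ℤ, actW l h = actW l g ^ n := by
  haveI : NeZero l := neZero_l l
  refine ⟨toCompletion W (SemidirectProduct.inl ga), (eta_mem_PiXW_iff l _).2 ⟨ga, rfl⟩, fun h hh => ?_⟩
  obtain ⟨k, hk⟩ := (mem_PiXW_iff l h).1 hh
  refine ⟨(k.val : ℤ), ?_⟩
  rw [zpow_natCast, actW, MonoidHom.comp_apply, MonoidHom.comp_apply, hk, ← map_pow, ρhat_eta, ρW_inl, ρF_ga,
    r_one_pow, ZMod.natCast_zmod_val]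

/-- `ι̲` (any `c ∈ Π_C̲ ∖ Π_X`) inverts `Gal(X̲/X)`: `c g c⁻¹ g ∈ Π_X̲ = Ker ρ̂` (`s r_k s r_k = 1`).
[cite: Mochizuki2012, IUTchI §1 p.37] -/
theorem conj_mul_mem_ker {c : profiniteCompletion W} (hc : c ∈ PiCbarW l) (hcX : c ∉ PiXW l)
    {g : profiniteCompletion W} (hg : g ∈ PiXW l) : c * g * c⁻¹ * g ∈ (ρhat l).ker := by
  obtain ⟨k, hk⟩ := (mem_PiXW_iff l g).1 hg
  rw [MonoidHom.mem_ker, map_mul, map_mul, map_mul, map_inv, ρhat_eq_sr_of_mem_PiCbarW l hc hcX, hk, inv_sr,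
    sr_mul_r, sr_mul_sr, r_mul_r, one_def]
  congr 1
  ring

/-- `Π_C̲` fixes the zero cusp `ε⁰ = 0`. [cite: Mochizuki2012, IUTchI §1 p.37] -/
theorem actW_zero_of_mem_PiCbarW {c : profiniteCompletion W} (hc : c ∈ PiCbarW l) : actW l c 0 = 0 := by
  rcases hc with h | h
  · rw [actW_apply, h, one_def, ArrowModel.cuspAct_r, add_zero]
  · rw [actW_apply, h, ArrowModel.cuspAct_sr, neg_zero, sub_zero]

/-- `ι̲` switches `ε′ = 1` and `ε″ = −1`. [cite: Mochizuki2012, IUTchI §1 p.37] -/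
theorem actW_one_of_mem_PiCbarW {c : profiniteCompletion W} (hc : c ∈ PiCbarW l) (hcX : c ∉ PiXW l) :
    actW l c 1 = -1 := by
  rw [actW_apply, ρhat_eq_sr_of_mem_PiCbarW l hc hcX, ArrowModel.cuspAct_sr, neg_zero, zero_sub]

/-- The cusp over `2ε̲`: `g·ε⁰ = ε′ ⇒ g²·ε⁰ = 2 = 2ε`. [cite: Mochizuki2012, IUTchI §1 p.37] -/
theorem actW_twoε {g : profiniteCompletion W} (hg : g ∈ PiXW l) (h : actW l g 0 = 1) : actW l (g * g) 0 = 2 := by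
  obtain ⟨k, hk⟩ := (mem_PiXW_iff l g).1 hg
  rw [actW_apply, hk, ArrowModel.cuspAct_r, zero_add] at h
  rw [actW_apply, map_mul, hk, r_mul_r, ArrowModel.cuspAct_r, zero_add, h]
  norm_num

/-! ### §4. The record `CuspGalois` at the datum -/

/-- **`CuspGalois` is INHABITED at the dihedral profinite datum** (jointly with `GeomOriginIota`, part 3): the cusp
action of `Ŵ` on `ℤ/l` through `Ŵ ↠ D_l`; `act_decomp` by `Ker ρ`-conjugation of the cusp words, `eq_of_conj` by
abc-iut-L5-d4's shadow in `P_l`, the remaining laws read off `ρ̂`. [cite: Mochizuki2012, IUTchI §1 p.37] -/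
def cuspGalois (h5 : 5 ≤ l) : (datum l h5).CuspGalois where
  act := actW l
  act_decomp := by
    intro g x
    obtain ⟨t, ht, h⟩ := exists_conj_decompW l h5 g x
    exact ⟨t, by rw [datum_PiXbar]; exact ht, h⟩
  eq_of_conj := by
    intro x y t ht h
    rw [datum_PiXbar] at ht
    exact eq_of_conj_decompW l h5 x y ht h
  isClosed_decomp := fun _ => Subgroup.isClosed_topologicalClosure _
  free := by
    intro g hg x h
    rw [datum_PiXbar]
    exact actW_free l hg x h
  transitive := actW_transitive l
  exists_generator := actW_exists_generator l
  conj_mul_mem_PiXbar := by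
    intro c hc hcX g hg
    rw [datum_PiXbar]
    exact conj_mul_mem_ker l hc hcX hg
  act_ε0 := fun c hc => actW_zero_of_mem_PiCbarW l hc
  act_ε1 := fun c hc hcX => actW_one_of_mem_PiCbarW l hc hcX
  act_twoε := fun g hg h => Or.inl (actW_twoε l hg h)

/-- **`CuspGalois` is inhabited at the datum.** [cite: Mochizuki2012, IUTchI §1 p.37] -/
theorem nonempty_cuspGalois (h5 : 5 ≤ l) : Nonempty (datum l h5).CuspGalois :=
  ⟨cuspGalois l h5⟩

/-- The record's action is `actW` (by `rfl`). [cite: Mochizuki2012, IUTchI §1 p.37] -/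
theorem cuspGalois_act (h5 : 5 ≤ l) : (cuspGalois l h5).act = actW l := rfl

end DihedralProfiniteModel

end PuncturedEllipticData

end Literature.IUT.HodgeTheaters

end
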